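import Summits.CriticalPhenomena.SAWScalingLimit.Theorems.CriticalBubbleBound.Negative.CriticalBubbleBoundLatticeKernel

/-!
# Negative-side results for the crux `SAWTotalPositivity.CriticalBubbleBound` (stmt-CriticalPhenomena-7117):
the free-endpoint / susceptibility strengthening is FALSE at `x_c` (`χ(x_c) = ∞`) (work-file §6).

Refuter `cdisprove` (standing adversary); the full indexed work file is
`Summits/CriticalPhenomena/SAWScalingLimit/Cruxes/CriticalBubbleBound/Disproof.lean`.
-/

noncomputable section

open MeasureTheory Filter Topology Set Function
open Literature.Probability.LatticeModels Literature.Probability.Percolation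
open Literature.Probability.RandomPlanarGeometry Literature.Probability.RandomPlanarGeometry.SAW
open Literature.Barriers.CriticalPhenomena.SupercriticalSAW
open scoped ENNReal NNReal BigOperators

namespace Summit.CriticalPhenomena.SAWScalingLimit.Theorems.CriticalBubbleBound.Negative

open Summit.CriticalPhenomena.SAWScalingLimit.Theses.SAWTotalPositivity (CriticalBubbleBound)

/-! ## §6 Natural strengthening FALSE at `x_c`: free endpoint / susceptibility bound -/

/-- The FREE-ENDPOINT strengthening of the crux: a uniform bound on the critical partition
function of SAWs from `u` to ANYWHERE, `Σ_v Z_Ω(u,v)`. -/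
def FreeEndpointBound : Prop :=
  ∃ C : ℝ≥0∞, C ≠ ⊤ ∧ ∀ (Ω : Set ℂ) (δ : ℝ) (u : Site 2), Bornology.IsBounded Ω → 0 < δ →
    ∑' v : Site 2, SAW.weight Ω δ u v univ ≤ C

/-- `c_n x_c^n ≥ 1` for every `n` (`μ^n ≤ c_n`, definition of `μ` as an infimum). [cite: BDGS2012, §1.3, eq. (1.12)] -/
theorem one_le_count_mul_criticalFugacity_pow (n : ℕ) :
    (1 : ℝ) ≤ (Zd.count 2 n : ℝ) * criticalFugacity ^ n := by
  have hμ : 0 < connectiveConstant := by linarith [two_le_connectiveConstant]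
  have h := Zd.pow_connectiveConstant_le_count 2 n
  rw [Zd.connectiveConstant_two] at h
  calc (1 : ℝ) = connectiveConstant ^ n * criticalFugacity ^ n := by
        rw [← mul_pow, criticalFugacity, mul_inv_cancel₀ hμ.ne', one_pow]
    _ ≤ (Zd.count 2 n : ℝ) * criticalFugacity ^ n :=
        mul_le_mul_of_nonneg_right h (pow_nonneg criticalFugacity_pos_lt_one'.1.le n)

/-- The disk `𝔻_{δ_N}` carries all SAWs from `0` of length `≤ N`: their total critical weight,
summed over the free endpoint, is at least `Σ_{n ≤ N} c_n x_c^n ≥ N + 1`. [folklore] -/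
theorem succ_le_tsum_weight_unitDisk (N : ℕ) :
    ((N : ℝ≥0∞) + 1) ≤ ∑' v : Site 2, SAW.weight unitDisk (meshOf N) 0 v univ := by
  classical
  set δ := meshOf N
  -- all SAWs from `0` of length `≤ N`, as triples `⟨n, v, p⟩`
  let A : Finset (Σ n : ℕ, Σ v : Site 2, (zdGraph 2).Walk (0 : Site 2) v) :=
    (Finset.range (N + 1)).sigma fun n => Zd.sawWalks 2 n
  have hA : ∀ a ∈ A, a.2.2.IsPath ∧ a.2.2.length = a.1 ∧ a.1 ≤ N := by
    rintro ⟨n, v, p⟩ ha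
    rw [Finset.mem_sigma, Finset.mem_range, Zd.mem_sawWalks] at ha
    exact ⟨ha.2.1, ha.2.2, Nat.lt_succ_iff.1 ha.1⟩
  have hsupp : ∀ a ∈ A, ∀ w ∈ a.2.2.support, w ∈ meshDomain unitDisk δ := by
    intro a ha w hw
    apply mem_meshDomain_unitDisk_of_abs_le
    intro i
    have h1 := abs_sub_le_length a.2.2 w hw i
    simp only [Pi.zero_apply, sub_zero] at h1
    have h2 := (hA a ha).2
    calc |w i| ≤ (a.2.2.length : ℤ) := h1
      _ ≤ N := by rw [h2.1]; exact_mod_cast h2.2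
  let T : {a // a ∈ A} → Σ v : Site 2, DomainSAW unitDisk δ 0 v := fun a =>
    ⟨a.1.2.1, toDisk δ ⟨a.1.2.2, (hA a.1 a.2).1⟩ (hsupp a.1 a.2)⟩
  have hT : ∀ a ∈ A.attach, ∀ b ∈ A.attach, T a = T b → a = b := by
    rintro ⟨⟨n, v, p⟩, ha⟩ _ ⟨⟨n', v', p'⟩, hb⟩ _ h
    simp only [T] at h
    obtain ⟨rfl, h2⟩ := Sigma.mk.inj_iff.1 h
    have h3 := toDisk_inj δ _ _ (eq_of_heq h2)
    have h4 : p = p' := congrArg Subtype.val h3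
    subst h4
    have e1 : p.length = n := (hA _ ha).2.1
    have e2 : p.length = n' := (hA _ hb).2.1
    have h5 : n = n' := e1.symm.trans e2
    subst h5
    rfl
  let f : (Σ v : Site 2, DomainSAW unitDisk δ 0 v) → ℝ≥0∞ := fun s =>
    ENNReal.ofReal (criticalFugacity ^ s.2.length)
  calc ((N : ℝ≥0∞) + 1) = ∑ n ∈ Finset.range (N + 1), (1 : ℝ≥0∞) := by simp
    _ ≤ ∑ n ∈ Finset.range (N + 1), (Zd.count 2 n : ℝ≥0∞) * ENNReal.ofReal (criticalFugacity ^ n) := by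
        refine Finset.sum_le_sum fun n _ => ?_
        have h := one_le_count_mul_criticalFugacity_pow n
        calc (1 : ℝ≥0∞) = ENNReal.ofReal 1 := ENNReal.ofReal_one.symm
          _ ≤ ENNReal.ofReal ((Zd.count 2 n : ℝ) * criticalFugacity ^ n) := ENNReal.ofReal_le_ofReal h
          _ = (Zd.count 2 n : ℝ≥0∞) * ENNReal.ofReal (criticalFugacity ^ n) := by
              rw [ENNReal.ofReal_mul (Nat.cast_nonneg _), ENNReal.ofReal_natCast]
    _ = ∑ a ∈ A, ENNReal.ofReal (criticalFugacity ^ a.1) := by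
        rw [Finset.sum_sigma]
        refine Finset.sum_congr rfl fun n _ => ?_
        dsimp only
        rw [Finset.sum_const, Zd.card_sawWalks, nsmul_eq_mul]
    _ = ∑ a ∈ A.attach, f (T a) := by
        rw [← Finset.sum_attach]
        refine Finset.sum_congr rfl fun a _ => ?_
        simp only [f, T, length_toDisk]
        rw [(hA a.1 a.2).2.1]
    _ = ∑ s ∈ A.attach.image T, f s := (Finset.sum_image hT).symm
    _ ≤ ∑' s : (Σ v : Site 2, DomainSAW unitDisk δ 0 v), f s := ENNReal.sum_le_tsum _
    _ = ∑' v : Site 2, ∑' γ : DomainSAW unitDisk δ 0 v, ENNReal.ofReal (criticalFugacity ^ γ.length) :=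
        ENNReal.tsum_sigma' _
    _ = ∑' v : Site 2, SAW.weight unitDisk δ 0 v univ := by
        refine tsum_congr fun v => ?_; rw [weight_univ]

/-- **THE FREE-ENDPOINT STRENGTHENING IS FALSE**: `Σ_v Z_Ω(u,v)` is NOT uniformly bounded at
`x_c` (it exceeds `N + 1` in the disk `𝔻_{δ_N}`: `χ(x_c) = Σ_n c_n x_c^n ≥ Σ_n 1 = ∞`). So any
proof of the crux must use that the SAW RETURNS next to its starting point (the polygon
structure `c_{m-1}(0,e) = (m/2) p_m`); no bound via the susceptibility / no `ℓ¹` bound on the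
critical two-point function can work, and the "bubble diagram" `B(x_c) = Σ_x G_{x_c}(0,x)²` of
Madras–Slade (expected infinite in `d = 2`) is NOT what the crux asserts. [cite: MadrasSlade1993, §1.4–§1.5] -/
theorem not_freeEndpointBound : ¬ FreeEndpointBound := by
  rintro ⟨C, hC, h⟩
  have key : ∀ N : ℕ, ((N : ℝ≥0∞) + 1) ≤ C := fun N =>
    (succ_le_tsum_weight_unitDisk N).trans (h unitDisk (meshOf N) 0 isBounded_unitDisk (meshOf_pos N))
  apply hC
  refine ENNReal.eq_top_of_forall_nnreal_le fun r => ?_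
  obtain ⟨N, hN⟩ := exists_nat_gt r
  calc (r : ℝ≥0∞) ≤ (N : ℝ≥0∞) := by exact_mod_cast hN.le
    _ ≤ (N : ℝ≥0∞) + 1 := le_self_add
    _ ≤ C := key N

end Summit.CriticalPhenomena.SAWScalingLimit.Theorems.CriticalBubbleBound.Negative
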